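import Summits.CriticalPhenomena.PercolationContinuityZ3.Theorems.PercNearOneGluingNoHeavyLowerTailStarSetUnitBound
import Summits.CriticalPhenomena.PercolationContinuityZ3.Theorems.PercNearOneGluingNoHeavyLowerTailStarSetChargingReduction
import HarnessLib

/-!
# `NoHeavyLowerTail` (stmt-CriticalPhenomena-4575) — the class-level charging theorem (LEAN-BLUEPRINT-U1.md §B; U1-PROOF.md §§2–9)

Support file (prover `prim-gen-swap` gen 15; `--supports stmt-CriticalPhenomena-4575`).  No definitions, no named facts, no sorries.

`StarSet.charging_classLevel` is the hypothesis `hclass` of `StarSet.mwf_supply_U1_of_classLevel` (p215931) at general index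
types: it follows from the unit bound `StarSet.unit_bound` by `StarSet.charging_classLevel_of_units` (p216096), after disposing of
the empty class type and supplying the free rule (the Ω-chord through `q₀` if any, else the least Ω-chord).

* `StarSet.charging_classLevel`.
-/

namespace Summit.CriticalPhenomena.PercolationContinuityZ3.Theorems

open Finset
open scoped BigOperators Classical

namespace StarSet

variable {ι V : Type*} [Fintype ι] [LinearOrder ι] [Fintype V] [DecidableEq V]

/-- **The class-level charging theorem (LEAN-BLUEPRINT-U1.md §B; the cell's `ChargingTargets.TARGET`).**  For a two-port class system
(classes `X` with ports `P X ≠ P' X`, distinct port pairs, a forest `F` in leaf-peeling order, chords dominated through `dom`) and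
abstract weights/odds `θ, O, Φ` with the four odds inequalities, the signed configuration count `Σ_S W(S)·(n(S) − y(S))` is at most the
class-word budget `Σ_T C_T`.  Proof: `charging_classLevel_of_units` (p216096) with the unit bound `unit_bound`. -/
theorem charging_classLevel (P P' : ι → V) (hPP' : ∀ X, P X ≠ P' X)
    (hinj : Function.Injective fun X => (s(P X, P' X) : Sym2 V)) (r : V) (F : Finset ι)
    (hforest : ∀ K ∈ F, ∀ I ∈ F, K < I → P' K ≠ P I ∧ P' K ≠ P' I)
    (θ : ι → ℝ) (hθ0 : ∀ X, 0 ≤ θ X) (hθ1 : ∀ X, θ X < 1)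
    (O : ι → V → ℝ) (hO0 : ∀ X d, 0 ≤ O X d) (Φ : ι → ℝ)
    (hO1 : ∀ X d, (P X = d ∨ P' X = d) → θ X ≤ (1 - θ X) * O X d)
    (hO2 : ∀ X, Φ X ^ 2 ≤ O X (P X) * O X (P' X))
    (hΦ4 : ∀ X, 4 * θ X ≤ Φ X) (hΦsq : ∀ X, θ X ≤ Φ X ^ 2)
    (dom : ι → V → ι)
    (hdom : ∀ X ∉ F, ∀ d, (P X = d ∨ P' X = d) →
      dom X d ∈ F ∧ (P (dom X d) = d ∨ P' (dom X d) = d) ∧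
        (∀ u, (P (dom X d) = u ∨ P' (dom X d) = u) → (P X = u ∨ P' X = u) → u = d) ∧ θ X ≤ θ (dom X d)) :
    ∑ S ∈ (univ : Finset ι).powerset, ((∏ k ∈ S, θ k) * ∏ k ∈ univ \ S, (1 - θ k)) *
        ((∑ κ ∈ (univ \ F).filter (fun κ => P κ ≠ r ∧ P' κ ≠ r),
            (if (κ ∈ S ∧ ∀ j ∈ univ.filter (fun j => ¬ (P j = P κ ∨ P j = P' κ ∨ P' j = P κ ∨ P' j = P' κ)), j ∉ S)
              then (1 : ℝ) else 0)) -
          ((if (∀ I ∈ F, I ∉ S) then (1 : ℝ) else 0) +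
            ∑ a ∈ F.filter (fun a => P a = r), (if (a ∈ S ∧ ∀ b ∈ F.filter (· < a), b ∉ S) then (1 : ℝ) else 0))) ≤
      ∑ T ∈ (univ : Finset ι).powerset,
        ∑ δ ∈ (univ : Finset (ι → Bool)).filter (fun δ => (∀ X ∉ T, δ X = false) ∧
            3 ≤ (T.image fun X => if δ X then P X else P' X).card ∧ r ∉ T.image fun X => if δ X then P X else P' X),
          ∏ X ∈ T, O X (if δ X then P X else P' X) := by
  rcases isEmpty_or_nonempty ι with hι | hι
  · -- no classes: the only configuration is `∅`, of weight 1, with `n = 0`, `y = 1`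
    have hF : F = ∅ := eq_empty_of_isEmpty F
    subst hF
    simp
  · inhabit ι
    refine charging_classLevel_of_units P P' r F θ _
      (fun S => if h : ∃ X ∈ S.filter (fun X => X ∈ (univ \ F).filter (fun κ => P κ ≠ r ∧ P' κ ≠ r) ∧
          ∀ Y ∈ S, (P Y = P X ∨ P Y = P' X ∨ P' Y = P X ∨ P' Y = P' X)),
          ∃ I ∈ F, P' I = r ∧ (P X = P I ∨ P' X = P I) then h.choose
        else if h' : (S.filter (fun X => X ∈ (univ \ F).filter (fun κ => P κ ≠ r ∧ P' κ ≠ r) ∧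
          ∀ Y ∈ S, (P Y = P X ∨ P Y = P' X ∨ P' Y = P X ∨ P' Y = P' X))).Nonempty then
          (S.filter (fun X => X ∈ (univ \ F).filter (fun κ => P κ ≠ r ∧ P' κ ≠ r) ∧
            ∀ Y ∈ S, (P Y = P X ∨ P Y = P' X ∨ P' Y = P X ∨ P' Y = P' X))).min' h'
        else default)
      (fun S hS => ?_) ?_
    · -- the free rule picks an Ω-chord
      split_ifs with h1
      · exact h1.choose_spec.1
      · exact min'_mem _ _
    · exact unit_bound P P' hPP' hinj r F hforest θ hθ0 hθ1 O hO0 Φ hO1 hO2 hΦ4 hΦsq dom hdom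

end StarSet

end Summit.CriticalPhenomena.PercolationContinuityZ3.Theorems
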